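import Summits.ResolutionOfSingularities.ResolutionOfSingularities.Theorems.ChainW52TargetsF7BetaRP
import Summits.ResolutionOfSingularities.ResolutionOfSingularities.Theorems.FrobeniusClosingPatchingRelPerfectDepthPhaseCEndTailLP
import Summits.ResolutionOfSingularities.ResolutionOfSingularities.Theorems.FrobeniusClosingPatchingRelPerfectDepthBetaTwoComposition
import Summits.ResolutionOfSingularities.ResolutionOfSingularities.Theorems.FrobeniusClosingPatchingRelPerfectTowerContraction
import Summits.ResolutionOfSingularities.ResolutionOfSingularities.Theorems.ValuativePatchingRelBlowupSequenceComposite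
import Literature.AlgebraicGeometry.Resolution.ExcellentBlowup
import HarnessLib

/-!
# Crux `PatchingRelPerfect` (stmt-ResolutionOfSingularities-16161), chain W5.2 — F7(β) (β-AX) d = 2, T5 OVER `PhaseCOne`:
# the composition closes from C-I΄s target of record `PhaseCOne P` WITHOUT the END TAIL (targets v7 `ChainW52TargetsF7BetaRP`)

[OURS · L1 W5.2 · F7(β) (β-AX) · T5 variant · hand res-D-pv-021 g9; the proof body is res-D-repro-1 AS res-L1-repro-3΄s T5 v6
`betaTwo_atomConclusion_of_targetsR` (p557684) VERBATIM except the T3 / E1 / T4 block, which is replaced by res-D-pv-021΄s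
`ChainW52F7BetaR.exists_principalization_of_phaseCOne` (p557636: `PhaseCOne P` ⇒ a regular-centre tower over `cosupp S.K` with regular top
principalising `S.K`, = T4 on the residual + `CentreSeq.append` + multiply-back).]  NOT a statement of the manuscript under review; AI-written,
weaker than expert review.  Mathlib + landed W5.2 files only; no definition, no fact, no sorry.

WHY: `ChainW52F7BetaR.BetaTwoComposition₂` consumes T3 as `PhaseCTermination₂ P` (residual factorisation `M · Sf.K` with `M` EFFECTIVE CARTIER
and `Sf` format-snc), but the composition reads it only through `IsLocallyPrincipal` (`hM.isLocallyPrincipal`, `IsFormatSncOn.exists_centreSeq`);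
the literal END TAIL `PhaseCOne P → PhaseCTermination₂ P` would require an effective-Cartier UPGRADE of T4΄s locally-principal output (true,
not exported).  This file proves the composition directly from `PhaseCOne P`:

* **`betaTwo_atomConclusion_of_phaseCOne : InitialMultiHost₂ → CJSTransport₂ → FormatEndOnCyl₂ →
  (∃ P, StepStable P ∧ AtlasInitial P ∧ PhaseCOne P) → BetaTwoAtomConclusion₂`** (targets v7 `ChainW52TargetsF7BetaRP` of record, RULINGs G12-3 / G12-4; `PhaseCOne` is δ-identical to v6, so
  the v6 lemma `ChainW52F7BetaR.exists_principalization_of_phaseCOne` is used through a one-line `have`).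

So the (β-AX) closer reads `betaTwo_atomConclusion_of_phaseCOne T0_holds (cjsTransport₂_of_cjsB hlift hCJS) ChainW52F7Beta.formatEndOnCyl₂_holds
⟨CylReach, stepStable_cylReach, atlasInitial_cylReach, phaseCOne_cylReach⟩` — C-I΄s `PhaseCOne CylReach` closes the CORE.

## References
* J. Kollár, *Lectures on Resolution of Singularities* (2007), (3.111) Step 3. [Kollar2007]
* M. Temkin, *Desingularization of quasi-excellent schemes in characteristic zero*, Adv. Math. 219 (2008), Lemma 2.1.4. [Temkin2008]
* The Stacks Project, Tags 080A, 080B. [StacksProject]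
-/

-- `Summit.<Summit>.<Sub>.Theorems` with `Sub = Summit` (single-conjunct summit, D-0017)
set_option linter.dupNamespace false

noncomputable section

open CategoryTheory CategoryTheory.Limits AlgebraicGeometry TopologicalSpace IsLocalRing
open Literature.AlgebraicGeometry.Resolution Scheme.IdealSheafData
open Literature.AlgebraicGeometry.Hironaka2017.MonomialPart Literature.AlgebraicGeometry.Motives

namespace Summit.ResolutionOfSingularities.ResolutionOfSingularities.Theorems

universe u

namespace ChainW52F7BetaRP

open DepthMultiHost

section T5One

open DepthTargets

/-- [OURS · L1 W5.2 · F7(β) (β-AX) T5 OVER `PhaseCOne`] **`betaTwo_atomConclusion_of_phaseCOne`**: T0, T2, T2c and ONE pole atlas `P` with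
`StepStable P`, `AtlasInitial P` and C-I΄s target `PhaseCOne P` give the (β) d = 2 atom conclusion — res-L1-repro-3΄s composition (p557684)
with the Phase C block read through `exists_principalization_of_phaseCOne` (p557636) instead of `PhaseCTermination₂` + E1 + T4.  Fact-free
as a composition (F-32bR enters only through the `CJSTransport₂` hypothesis). [cite: Kollar2007, (3.111) Step 3] [cite: StacksProject, Tag 080A]
[cite: Temkin2008, Lemma 2.1.4] -/
theorem betaTwo_atomConclusion_of_phaseCOne :
    InitialMultiHost₂.{u} → CJSTransport₂.{u} → FormatEndOnCyl₂.{u} →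
      (∃ P : ∀ ⦃X : Scheme.{u}⦄ (S : MultiHostState X), CylState S → Prop,
        StepStable P ∧ AtlasInitial P ∧ PhaseCOne P) →
      BetaTwoAtomConclusion₂.{u} := by
  rintro hT0 hT2 hT2c ⟨Pa, hPa, hPa₀, hC⟩ S iS₁ iS₂ iS₃ hdim κ₀ iκ σ hσ x hx s Pf hPf hI T f hf
  classical
  -- discard the zero forms
  obtain ⟨s', e, hne, hIe⟩ := ChainW52F7Beta.exists_gradedMemberIdeal_eq_of_ne_zero σ x 2 2 Pf
  rw [← hIe] at hI hf
  -- T0: the initial cylinder state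
  obtain ⟨X, g, i, K, instX, St, cyl, instZ₁, instZ₂, hinv, hXexc, hStK, hn0, h𝓔, hrange, hV, hZreg, hZexc, hZdim⟩ :=
    hT0 S hdim κ₀ σ hσ x hx s' (Pf ∘ e) (fun k => hPf (e k)) hne
  haveI := hinv.isClosedImmersion
  -- the atlas holds at generation 0 (`AtlasInitial`: every antecedent is in T0΄s conclusion)
  have hshape : InitialShape St cyl := by
    refine ⟨S, iS₁, iS₂, iS₃, hdim, κ₀, iκ, σ, hσ, x, hx, s', Pf ∘ e, fun k => hPf (e k), hne, g, i, ?_, hrange⟩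
    rw [hStK]
    exact hinv
  have hP0 : Pa St cyl := hPa₀ St cyl hV hZreg hZexc hZdim h𝓔 hXexc hn0 hshape
  -- T2: one CJS run, transported
  obtain ⟨X₁, π, instX₁, S₁, cyl₁, ρ, instZ₃, instZ₄, 𝓔₁, hPS₁, ⟨Q, hπQ, hQsupp⟩, hX₁reg, hK₁, hn₁, -, hZ₁reg, hsnc₁, hnodup₁, -,
    hirr₁, hbd₁, htr₁⟩ := hT2 Pa hPa hinv.isRegular St cyl hZreg hZexc hZdim h𝓔 hP0
  -- T2c: format-snc END on the cylinder open
  obtain ⟨𝓒, 𝓗, hfmt⟩ := hT2c hX₁reg S₁ cyl₁ hZ₁reg 𝓔₁ hsnc₁ hnodup₁ hirr₁ hbd₁ htr₁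
  -- T3 = C-I `PhaseCOne` read through the END-TAIL principalisation (T4 on the residual, appended): ONE tower
  have hC' : ChainW52F7BetaR.PhaseCOne Pa := hC
  obtain ⟨s₂, -, hs₂over, htop₂, hlp₂⟩ :=
    ChainW52F7BetaR.exists_principalization_of_phaseCOne Pa hC' hX₁reg (hπQ.isExcellent hXexc) S₁ cyl₁ hZ₁reg (hn₁ ▸ hn0 :)
      𝓒 𝓗 hfmt hPS₁
  -- the format on `X` and the blow-up data of `g`
  obtain ⟨M₀, hM₀, hIMK⟩ := hinv.exists_format
  obtain ⟨K₀, hgK₀, hK₀⟩ := hinv.exists_isBlowup_supported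
  -- every centre lies over the closed point
  have hKsupp : (K.support : Set X) ⊆ g ⁻¹' {IsLocalRing.closedPoint S} := by
    intro y hy
    have hy' : y ∈ (i.ker.support : Set X) := by
      have h2 : K.support ≤ (i.ker ^ 2).support := support_antitone hinv.ker_pow_le
      rw [support_pow i.ker 2 two_ne_zero] at h2
      exact h2 hy
    rw [Scheme.Hom.support_ker, i.isClosedEmbedding.isClosed_range.closure_eq] at hy'
    obtain ⟨e', rfl⟩ := hy'
    exact hinv.map_eq_closedPoint e'
  have hQsupp' : (Q.support : Set X) ⊆ g ⁻¹' {IsLocalRing.closedPoint S} := by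
    intro y hy
    obtain ⟨z, rfl⟩ := hrange (hQsupp hy)
    exact hinv.map_eq_closedPoint z
  haveI : IsNoetherianRing (CommRingCat.of S) := inferInstanceAs (IsNoetherianRing S)
  obtain ⟨K₁, hK₁b, hK₁s⟩ := IsBlowup.exists_isBlowup_comp_supported g K₀ π Q _ hgK₀ hK₀ hπQ hQsupp'
  have hS₁supp : (S₁.K.support : Set X₁) ⊆ (π ≫ g) ⁻¹' {IsLocalRing.closedPoint S} := by
    intro y hy
    rw [hK₁, hStK, support_comap] at hy
    exact hKsupp hy
  obtain ⟨Q₂, hQ₂b, hQ₂s⟩ :=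
    CentreSeq.exists_isBlowup_comp_of_centresOver s₂ _ (CentreSeq.CentresOver.mono s₂ hS₁supp hs₂over)
  obtain ⟨K₂, hK₂b, hK₂s⟩ := IsBlowup.exists_isBlowup_comp_supported (π ≫ g) K₁ s₂.comp Q₂ _ hK₁b hK₁s hQ₂b hQ₂s
  -- `I𝒪 = M₀𝒪 · S₁.K𝒪` on the top is locally principal
  have hlp : IsLocallyPrincipal
      ((affineBlowup.idealSheaf (gradedMemberIdeal σ x 2 2 (Pf ∘ e))).comap (s₂.comp ≫ π ≫ g)) := by
    rw [comap_comp, comap_comp, hIMK, comap_mul, ← hStK, ← hK₁, comap_mul]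
    exact ((hM₀.isLocallyPrincipal.comap π).comap s₂.comp).mul hlp₂
  exact atomConclusion_of_tower hI hK₂b hK₂s htop₂ hlp T f hf

end T5One

end ChainW52F7BetaRP

end Summit.ResolutionOfSingularities.ResolutionOfSingularities.Theorems

end
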